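import Mathlib.Algebra.CharP.Basic
import Mathlib.Algebra.GroupWithZero.Units.Fintype
import Mathlib.LinearAlgebra.Dual.Lemmas
import Mathlib.LinearAlgebra.FreeModule.Basic
import Mathlib.LinearAlgebra.Matrix.GeneralLinearGroup.Defs
import Literature.NumberTheory.GaloisRepresentations.ExtendedAdequateSubgroup
import Literature.RepresentationTheory.Semisimple.BurnsideMatrixSpan
import HarnessLib

/-!
# Crux `MuOrdinaryFamilyRT` (stmt-Langlands-13757), line `thorne-minimal-lift`:
# extended adequacy is stable under extension of the coefficient field (helper `isExtendedAdequate_baseChange`)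

Registered helper of leaf P2 (`isThorne2017Adequate_residual_pointRep`, wave 4; glue for
`stub_pointAutomorphic`).  Hypothesis (ii) of Thorne's Thm 5.1 (Math. Z. 285 (2017)) asks the image of the
RESIDUAL representation `ρ̄ : Γ_F → GL_n(𝔽̄_p)` on `Γ_{F(ζ_p)}` to be adequate, whereas the tree knows adequacy of
the heart `r̄_f^B : Γ_K → GL₃(𝔽₃)` over the PRIME field (`rbarExtendedAdequate`, …ThorneRbarAdequateUncond).
This file moves extended adequacy (Guralnick–Herzig–Tiep §1 = Thorne 2017 Def. 2.20, the tree's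
`Subgroup.IsExtendedAdequate`: (i) `Hom(H, k) = 0`, (ii) `H¹(H, ad/Z) = 0`, (iii) `M_n(k)` is spanned by the
semisimple elements of `H`) along an arbitrary homomorphism of fields `φ : k → k'` (automatically injective),
from `H ≤ GL_n(k)` to `GL_n(φ) H ≤ GL_n(k')`, complementing the ISOMORPHISM invariance `isExtendedAdequate_map`
of …ThorneAdequateTransport:

* § 1 `GL_n(φ)` is injective and preserves orders prime to the (common) characteristic.
* § 2 clause (i) (`addMonoidHom_eq_zero_baseChange`): a non-zero additive `F : GL_n(φ) H → k'` composed with a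
  `k`-linear functional `k' → k` not vanishing at a non-zero value (`k'` is a `k`-vector space through `φ`,
  Mathlib `Module.Projective.exists_dual_ne_zero`) is a non-zero additive map `H → k`.
* § 3 clause (iii) (`semisimpleSpan_eq_top_baseChange`): the semisimple elements of `H` map to semisimple elements
  of `GL_n(φ) H`, and a family of matrices spanning `M_n(k)` over `k` spans `M_n(k')` over `k'` after `φ`
  (tree `span_range_map_eq_top_iff`, BurnsideMatrixSpan).
* § 4 clause (ii) (`cocycles₁_le_coboundaries₁_baseChange`, for FINITE `H`): with `k'` a `k`-algebra and `(bᵢ)` a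
  `k`-basis of `k'`, the coordinate maps `M ↦ (bᵢ-coordinate of the entries of M) : M_n(k') → M_n(k)` are
  `H`-equivariant for the two adjoint actions, send scalars to scalars, and so descend to `Pᵢ : ad'/Z' → ad/Z`;
  conversely `J : ad/Z → ad'/Z'` is induced by `M ↦ φ(M)`.  A `1`-cocycle `c'` of `GL_n(φ) H ≅ H` with values in
  `ad'/Z'` has component cocycles `Pᵢ ∘ c'` with values in `ad/Z`, each a coboundary `h ↦ h • mᵢ − mᵢ` by (ii)
  for `H`; since `H` is finite only finitely many coordinates `i ∈ S` occur in the values of `c'`, and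
  `c' = Σ_{i ∈ S} bᵢ • J(Pᵢ ∘ c')` (`eq_sum_smul_of_forall_coordQuot_eq_zero`), so `c'` is the coboundary of
  `m = Σ_{i ∈ S} bᵢ • J(mᵢ)`.  (Finiteness — or finite generation — of `H` is needed for an infinite extension
  `k'/k`: `H¹(H, −)` need not commute with infinite direct sums; images of residual representations are finite.)
* § 5 the packaged statements: `isExtendedAdequate_map_ringHom` (any universes) and the registered
  `isExtendedAdequate_baseChange` (level `0`, the case `𝔽₃ → ℤ̄₃/𝔪` of the line).  No definition, no named fact.
-/

-- `Summit.Langlands.Langlands.…` (summit = sub-problem name, D-0017 layout) trips `dupNamespace` on every decl.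
set_option linter.dupNamespace false

namespace Summit.Langlands.Langlands.Cruxes.MuOrdinaryFamilyRT.ThorneMinimalLift

open Literature.NumberTheory.GaloisRepresentations Literature.RepresentationTheory.Semisimple

noncomputable section

universe u v

/-! ## 1. `GL_n(φ)` along a homomorphism of fields -/

section RingHom

variable {k : Type u} {k' : Type v} [Field k] [Field k'] {n : ℕ} (φ : k →+* k')

/-- `GL_n(φ)` is injective for a homomorphism of fields `φ`. -/
theorem glMap_injective_ringHom :
    Function.Injective (Matrix.GeneralLinearGroup.map (n := Fin n) φ) := fun _ _ h =>
  Units.ext (Matrix.map_injective φ.injective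
    (congrArg (fun g : GL (Fin n) k' => (g : Matrix (Fin n) (Fin n) k')) h))

/-- The matrix of `GL_n(φ) g` is `φ` applied entrywise. -/
theorem coe_glMap_ringHom (g : GL (Fin n) k) :
    ((Matrix.GeneralLinearGroup.map φ g : GL (Fin n) k') : Matrix (Fin n) (Fin n) k') =
      (g : Matrix (Fin n) (Fin n) k).map φ := rfl

/-- The matrix of `(GL_n(φ) g)⁻¹` is `φ` applied entrywise to `g⁻¹`. -/
theorem coe_glMap_ringHom_inv (g : GL (Fin n) k) :
    (((Matrix.GeneralLinearGroup.map φ g)⁻¹ : GL (Fin n) k') : Matrix (Fin n) (Fin n) k') =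
      ((g⁻¹ : GL (Fin n) k) : Matrix (Fin n) (Fin n) k).map φ := by rw [← map_inv]; rfl

/-- `GL_n(φ)` preserves the property "of order prime to the characteristic" (semisimplicity in the
GHTT sense): `φ` is injective, so `ringChar k' = ringChar k` and `GL_n(φ)` preserves orders. -/
theorem coprime_orderOf_glMap_ringHom {g : GL (Fin n) k} (hg : (orderOf g).Coprime (ringChar k)) :
    (orderOf (Matrix.GeneralLinearGroup.map φ g)).Coprime (ringChar k') := by
  haveI : CharP k' (ringChar k) := charP_of_injective_ringHom (f := φ) φ.injective (ringChar k)
  rw [ringChar.eq k' (ringChar k), orderOf_injective _ (glMap_injective_ringHom φ)]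
  exact hg

/-! ## 2. Clause (i): `Hom(GL_n(φ) H, k') = 0` -/

variable {H : Subgroup (GL (Fin n) k)}

/-- **Clause (i) under base change.**  If every additive homomorphism `H → k` vanishes, so does every
additive homomorphism `GL_n(φ) H → k'`: compose with `H ≅ GL_n(φ) H` and with a `k`-linear functional
`k' → k` (for the `k`-structure of `k'` through `φ`) which does not vanish at a non-zero value. -/
theorem addMonoidHom_eq_zero_baseChange (hH : ∀ f : Additive H →+ k, f = 0)
    (F : Additive ↥(H.map (Matrix.GeneralLinearGroup.map φ)) →+ k') : F = 0 := by
  letI : Algebra k k' := φ.toAlgebra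
  set ψ := H.equivMapOfInjective _ (glMap_injective_ringHom (n := n) φ)
  by_contra hF
  obtain ⟨x, hx⟩ : ∃ x, F x ≠ 0 := by
    by_contra h
    exact hF (AddMonoidHom.ext fun x => not_not.1 (not_exists.1 h x))
  obtain ⟨l, hl⟩ := Module.Projective.exists_dual_ne_zero k hx
  let F₀ : Additive H →+ k :=
    l.toAddMonoidHom.comp (F.comp (MonoidHom.toAdditive ψ.toMonoidHom))
  have h0 := DFunLike.congr_fun (hH F₀) (Additive.ofMul (ψ.symm x.toMul))
  apply hl
  simpa [F₀] using h0

/-! ## 3. Clause (iii): the semisimple elements of `GL_n(φ) H` span `M_n(k')` -/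

/-- **Clause (iii) under base change.**  If the semisimple elements of `H` span `M_n(k)` over `k`, the
semisimple elements of `GL_n(φ) H` span `M_n(k')` over `k'`. -/
theorem semisimpleSpan_eq_top_baseChange (hH : Subgroup.semisimpleSpan H = ⊤) :
    Subgroup.semisimpleSpan (H.map (Matrix.GeneralLinearGroup.map φ)) = ⊤ := by
  -- the family of semisimple elements of `H`
  set X : {h : H // (orderOf (h : GL (Fin n) k)).Coprime (ringChar k)} → Matrix (Fin n) (Fin n) k :=
    fun h => ((h.1 : GL (Fin n) k) : Matrix (Fin n) (Fin n) k) with hXdef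
  have hX : Submodule.span k (Set.range X) = Subgroup.semisimpleSpan H := by
    rw [Subgroup.semisimpleSpan_def]
    congr 1
    ext M
    simp only [Set.mem_range, Set.mem_setOf_eq, hXdef, Subtype.exists, exists_prop]
  have htop : Submodule.span k' (Set.range fun i => (X i).map φ) = ⊤ :=
    (span_range_map_eq_top_iff φ X).2 (hX.trans hH)
  rw [eq_top_iff, ← htop, Submodule.span_le]
  rintro _ ⟨⟨h, hh⟩, rfl⟩
  exact Subgroup.mem_semisimpleSpan_of_coprime _
    ⟨Matrix.GeneralLinearGroup.map φ (h : GL (Fin n) k), Subgroup.mem_map_of_mem _ h.2⟩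
    (coprime_orderOf_glMap_ringHom φ hh)

end RingHom

/-! ## 4. Clause (ii): `H¹(GL_n(φ) H, ad'/Z') = 0` for finite `H`

Throughout this section `k'` is a `k`-algebra and `φ = algebraMap k k'`. -/

section Algebra

variable {k : Type u} {k' : Type v} [Field k] [Field k'] [Algebra k k'] {n : ℕ}

/-- For a `k`-linear `f : k' → k` and matrices `A, B` over `k`: `f(φ(A) M φ(B)) = A f(M) B` entrywise
(`f` is `k`-linear and `k'` is commutative). -/
theorem map_conj_map_algebraMap (f : k' →ₗ[k] k) (A B : Matrix (Fin n) (Fin n) k)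
    (M : Matrix (Fin n) (Fin n) k') :
    (A.map (algebraMap k k') * M * B.map (algebraMap k k')).map f = A * M.map f * B := by
  ext i j
  simp only [Matrix.map_apply, Matrix.mul_apply, Finset.sum_mul, map_sum]
  refine Finset.sum_congr rfl fun x _ => Finset.sum_congr rfl fun y _ => ?_
  rw [mul_comm (algebraMap k k' (A i y)) (M y x), mul_assoc, ← map_mul,
    ← Algebra.commutes (A i y * B x j) (M y x), ← Algebra.smul_def, map_smul, smul_eq_mul]
  ring

/-- `φ(c • 1) = φ(c) • 1` lies in `Z'`: `M ↦ φ(M)` maps scalars to scalars. -/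
theorem map_algebraMap_mem_scalarMatrices {M : Matrix (Fin n) (Fin n) k} (hM : M ∈ scalarMatrices (Fin n) k) :
    M.map (algebraMap k k') ∈ scalarMatrices (Fin n) k' := by
  obtain ⟨c, rfl⟩ := (mem_scalarMatrices_iff M).1 hM
  have h : (c • (1 : Matrix (Fin n) (Fin n) k)).map (algebraMap k k') =
      algebraMap k k' c • (1 : Matrix (Fin n) (Fin n) k') := by
    ext i j
    by_cases hij : i = j <;> simp [hij]
  rw [h]
  exact smul_one_mem_scalarMatrices k' _

/-- A `k`-linear coordinate `f : k' → k` maps scalars to scalars: `f(c • 1) = f(c) • 1 ∈ Z`. -/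
theorem map_linearMap_mem_scalarMatrices (f : k' →ₗ[k] k) {M : Matrix (Fin n) (Fin n) k'}
    (hM : M ∈ scalarMatrices (Fin n) k') : M.map f ∈ scalarMatrices (Fin n) k := by
  obtain ⟨c, rfl⟩ := (mem_scalarMatrices_iff M).1 hM
  have h : (c • (1 : Matrix (Fin n) (Fin n) k')).map f = f c • (1 : Matrix (Fin n) (Fin n) k) := by
    ext i j
    by_cases hij : i = j <;> simp [hij]
  rw [h]
  exact smul_one_mem_scalarMatrices k _

/-- **The inclusion `J : ad/Z → ad'/Z'`** induced by `M ↦ φ(M)`, recorded through its defining property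
(no definition is introduced). -/
theorem exists_inclQuot :
    ∃ J : (Matrix (Fin n) (Fin n) k ⧸ scalarMatrices (Fin n) k) →+
        (Matrix (Fin n) (Fin n) k' ⧸ scalarMatrices (Fin n) k'),
      ∀ M, J (Submodule.Quotient.mk M) = Submodule.Quotient.mk (M.map (algebraMap k k')) := by
  let L : Matrix (Fin n) (Fin n) k →ₛₗ[algebraMap k k'] Matrix (Fin n) (Fin n) k' :=
    { toFun := fun M => M.map (algebraMap k k')
      map_add' := fun M N => Matrix.map_add _ (map_add _) M N
      map_smul' := fun c M => by
        ext i j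
        simp only [Matrix.map_apply, Matrix.smul_apply, smul_eq_mul, map_mul] }
  have hL : scalarMatrices (Fin n) k ≤ (scalarMatrices (Fin n) k').comap L := fun M hM =>
    Submodule.mem_comap.2 (map_algebraMap_mem_scalarMatrices hM)
  exact ⟨(Submodule.mapQ _ _ L hL).toAddMonoidHom, fun M => rfl⟩

/-- **The coordinate maps `P_f : ad'/Z' → ad/Z`** induced by a `k`-linear `f : k' → k` applied entrywise
(`k`-linear for the `k`-structure of `ad'/Z'` restricted from `k'`), recorded through their defining
property. -/
theorem exists_coordQuot (f : k' →ₗ[k] k) :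
    ∃ P : (Matrix (Fin n) (Fin n) k' ⧸ scalarMatrices (Fin n) k') →ₗ[k]
        (Matrix (Fin n) (Fin n) k ⧸ scalarMatrices (Fin n) k),
      ∀ M, P (Submodule.Quotient.mk M) = Submodule.Quotient.mk (M.map f) := by
  have hle : (scalarMatrices (Fin n) k').restrictScalars k ≤
      (scalarMatrices (Fin n) k).comap (f.mapMatrix : Matrix (Fin n) (Fin n) k' →ₗ[k] Matrix (Fin n) (Fin n) k) :=
    fun M hM => Submodule.mem_comap.2 (map_linearMap_mem_scalarMatrices f hM)
  exact ⟨(Submodule.mapQ _ _ _ hle).comp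
      (Submodule.Quotient.restrictScalarsEquiv k (scalarMatrices (Fin n) k')).symm.toLinearMap,
    fun M => rfl⟩

/-- `J` intertwines the adjoint actions of `g` on `ad/Z` and of `GL_n(φ) g` on `ad'/Z'`. -/
theorem inclQuot_adModScalar
    {J : (Matrix (Fin n) (Fin n) k ⧸ scalarMatrices (Fin n) k) →+
      (Matrix (Fin n) (Fin n) k' ⧸ scalarMatrices (Fin n) k')}
    (hJ : ∀ M, J (Submodule.Quotient.mk M) = Submodule.Quotient.mk (M.map (algebraMap k k')))
    (g : GL (Fin n) k) (x : Matrix (Fin n) (Fin n) k ⧸ scalarMatrices (Fin n) k) :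
    J (adModScalar (Fin n) k g x) =
      adModScalar (Fin n) k' (Matrix.GeneralLinearGroup.map (algebraMap k k') g) (J x) := by
  obtain ⟨M, rfl⟩ := Submodule.Quotient.mk_surjective _ x
  rw [adModScalar_apply_mk, hJ, hJ, adModScalar_apply_mk, coe_glMap_ringHom_inv, coe_glMap_ringHom,
    Matrix.map_mul, Matrix.map_mul]

/-- The coordinate maps intertwine the adjoint action of `GL_n(φ) g` on `ad'/Z'` with that of `g` on
`ad/Z` (the action is defined over `k`). -/
theorem coordQuot_adModScalar {f : k' →ₗ[k] k}
    {P : (Matrix (Fin n) (Fin n) k' ⧸ scalarMatrices (Fin n) k') →ₗ[k]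
      (Matrix (Fin n) (Fin n) k ⧸ scalarMatrices (Fin n) k)}
    (hP : ∀ M, P (Submodule.Quotient.mk M) = Submodule.Quotient.mk (M.map f))
    (g : GL (Fin n) k) (x : Matrix (Fin n) (Fin n) k' ⧸ scalarMatrices (Fin n) k') :
    P (adModScalar (Fin n) k' (Matrix.GeneralLinearGroup.map (algebraMap k k') g) x) =
      adModScalar (Fin n) k g (P x) := by
  obtain ⟨M, rfl⟩ := Submodule.Quotient.mk_surjective _ x
  rw [adModScalar_apply_mk, hP, hP, adModScalar_apply_mk, coe_glMap_ringHom_inv, coe_glMap_ringHom,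
    map_conj_map_algebraMap]

variable {ι : Type*} (b : Module.Basis ι k k')

/-- Expansion of an element of `k'` along a `k`-basis `b`, summed over any finite set of indices
containing the support of its coordinate vector. -/
theorem eq_sum_mul_algebraMap_coord (x : k') {T : Finset ι} (hT : (b.repr x).support ⊆ T) :
    x = ∑ i ∈ T, b i * algebraMap k k' (b.coord i x) := by
  conv_lhs => rw [← b.linearCombination_repr x]
  rw [Finsupp.linearCombination_apply, Finsupp.sum_of_support_subset _ hT _ fun i _ => zero_smul k (b i)]
  refine Finset.sum_congr rfl fun i _ => ?_
  rw [Algebra.smul_def, mul_comm]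
  rfl

/-- **Finitely many coordinates.**  Every element of `ad'/Z'` has only finitely many non-zero coordinates
`P_{b,i}` along a `k`-basis `b = (bᵢ)` of `k'`. -/
theorem exists_finset_coordQuot_eq_zero
    {P : ι → ((Matrix (Fin n) (Fin n) k' ⧸ scalarMatrices (Fin n) k') →ₗ[k]
      (Matrix (Fin n) (Fin n) k ⧸ scalarMatrices (Fin n) k))}
    (hP : ∀ i M, P i (Submodule.Quotient.mk M) = Submodule.Quotient.mk (M.map (b.coord i)))
    (x : Matrix (Fin n) (Fin n) k' ⧸ scalarMatrices (Fin n) k') :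
    ∃ S : Finset ι, ∀ i ∉ S, P i x = 0 := by
  classical
  obtain ⟨M, rfl⟩ := Submodule.Quotient.mk_surjective _ x
  refine ⟨Finset.univ.biUnion fun p : Fin n × Fin n => (b.repr (M p.1 p.2)).support, fun i hi => ?_⟩
  rw [hP]
  have h0 : M.map (b.coord i) = 0 := by
    ext a c
    rw [Matrix.map_apply, Matrix.zero_apply, Module.Basis.coord_apply]
    exact Finsupp.notMem_support_iff.1 fun h =>
      hi (Finset.mem_biUnion.2 ⟨(a, c), Finset.mem_univ _, h⟩)
  rw [h0, Submodule.Quotient.mk_zero]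

/-- **Reconstruction from the coordinates.**  If the coordinates `P_{b,i} x` of `x ∈ ad'/Z'` vanish outside
a finite set `S`, then `x = Σ_{i ∈ S} bᵢ • J(P_{b,i} x)`. -/
theorem eq_sum_smul_of_forall_coordQuot_eq_zero
    {P : ι → ((Matrix (Fin n) (Fin n) k' ⧸ scalarMatrices (Fin n) k') →ₗ[k]
      (Matrix (Fin n) (Fin n) k ⧸ scalarMatrices (Fin n) k))}
    (hP : ∀ i M, P i (Submodule.Quotient.mk M) = Submodule.Quotient.mk (M.map (b.coord i)))
    {J : (Matrix (Fin n) (Fin n) k ⧸ scalarMatrices (Fin n) k) →+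
      (Matrix (Fin n) (Fin n) k' ⧸ scalarMatrices (Fin n) k')}
    (hJ : ∀ M, J (Submodule.Quotient.mk M) = Submodule.Quotient.mk (M.map (algebraMap k k')))
    (x : Matrix (Fin n) (Fin n) k' ⧸ scalarMatrices (Fin n) k') (S : Finset ι)
    (hS : ∀ i ∉ S, P i x = 0) :
    x = ∑ i ∈ S, b i • J (P i x) := by
  classical
  obtain ⟨M, rfl⟩ := Submodule.Quotient.mk_surjective _ x
  -- a finite set of indices carrying all the entries of `M`, and containing `S`
  set T : Finset ι := S ∪ Finset.univ.biUnion fun p : Fin n × Fin n => (b.repr (M p.1 p.2)).support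
    with hTdef
  have hST : S ⊆ T := Finset.subset_union_left
  have hsupp : ∀ a c, (b.repr (M a c)).support ⊆ T := fun a c =>
    (Finset.subset_biUnion_of_mem (fun p : Fin n × Fin n => (b.repr (M p.1 p.2)).support)
      (Finset.mem_univ (a, c))).trans Finset.subset_union_right
  -- expansion of `M` along the basis
  have hM : M = ∑ i ∈ T, b i • (M.map (b.coord i)).map (algebraMap k k') := by
    ext a c
    rw [Matrix.sum_apply]
    simp only [Matrix.smul_apply, Matrix.map_apply, smul_eq_mul]
    exact eq_sum_mul_algebraMap_coord b (M a c) (hsupp a c)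
  have hx : (Submodule.Quotient.mk M : Matrix (Fin n) (Fin n) k' ⧸ scalarMatrices (Fin n) k') =
      ∑ i ∈ T, b i • J (P i (Submodule.Quotient.mk M)) := by
    conv_lhs => rw [hM]
    rw [← Submodule.mkQ_apply, map_sum]
    refine Finset.sum_congr rfl fun i _ => ?_
    rw [map_smul, Submodule.mkQ_apply, hP, hJ]
  refine hx.trans (Finset.sum_subset (f := fun i => b i • J (P i (Submodule.Quotient.mk M))) hST ?_).symm
  intro i _ hi
  change b i • J (P i (Submodule.Quotient.mk M)) = 0
  rw [hS i hi, map_zero, smul_zero]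

variable {H : Subgroup (GL (Fin n) k)}

/-- **Clause (ii) under base change, for finite `H`.**  If every `1`-cocycle `H → ad/Z` is a
`1`-coboundary, so is every `1`-cocycle `GL_n(φ) H → ad'/Z'` (`φ = algebraMap k k'`): its coordinates along a
`k`-basis of `k'` are cocycles of `H ≅ GL_n(φ) H` with values in `ad/Z`, hence coboundaries of elements `mᵢ`,
only finitely many coordinates occur, and the cocycle is the coboundary of `Σ bᵢ • J(mᵢ)`. -/
theorem cocycles₁_le_coboundaries₁_baseChange [Finite H]
    (hH : groupCohomology.cocycles₁ (Rep.of (Subgroup.adModScalarRep H)) ≤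
      groupCohomology.coboundaries₁ (Rep.of (Subgroup.adModScalarRep H))) :
    groupCohomology.cocycles₁
        (Rep.of (Subgroup.adModScalarRep (H.map (Matrix.GeneralLinearGroup.map (algebraMap k k'))))) ≤
      groupCohomology.coboundaries₁
        (Rep.of (Subgroup.adModScalarRep (H.map (Matrix.GeneralLinearGroup.map (algebraMap k k'))))) := by
  classical
  let b := Module.Free.chooseBasis k k'
  obtain ⟨J, hJ⟩ := exists_inclQuot (k := k) (k' := k') (n := n)
  have hP : ∀ i : Module.Free.ChooseBasisIndex k k',
      ∃ P : (Matrix (Fin n) (Fin n) k' ⧸ scalarMatrices (Fin n) k') →ₗ[k]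
        (Matrix (Fin n) (Fin n) k ⧸ scalarMatrices (Fin n) k),
        ∀ M, P (Submodule.Quotient.mk M) = Submodule.Quotient.mk (M.map (b.coord i)) :=
    fun i => exists_coordQuot (b.coord i)
  choose P hP using hP
  refine (cocycles₁_le_coboundaries₁_iff_forall _).2 fun c' hc' => ?_
  set ψ := H.equivMapOfInjective _ (glMap_injective_ringHom (n := n) (algebraMap k k')) with hψdef
  have hψ : ∀ h : H,
      ((ψ h : ↥(H.map (Matrix.GeneralLinearGroup.map (algebraMap k k')))) : GL (Fin n) k') =
        Matrix.GeneralLinearGroup.map (algebraMap k k') (h : GL (Fin n) k) :=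
    fun h => Subgroup.coe_equivMapOfInjective_apply H _ (glMap_injective_ringHom _) h
  -- the component cocycles `h ↦ P i (c' (ψ h))` of `H` with values in `ad/Z`
  have hc : ∀ i, ∀ g h : H,
      P i (c' (ψ (g * h))) = Subgroup.adModScalarRep H g (P i (c' (ψ h))) + P i (c' (ψ g)) := by
    intro i g h
    rw [map_mul, hc', map_add]
    congr 1
    change P i (adModScalar (Fin n) k'
      ((ψ g : ↥(H.map (Matrix.GeneralLinearGroup.map (algebraMap k k')))) : GL (Fin n) k') (c' (ψ h))) =
      adModScalar (Fin n) k (g : GL (Fin n) k) (P i (c' (ψ h)))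
    rw [hψ, coordQuot_adModScalar (hP i)]
  -- each is a coboundary
  have hm : ∀ i, ∃ m : Matrix (Fin n) (Fin n) k ⧸ scalarMatrices (Fin n) k,
      ∀ g : H, P i (c' (ψ g)) = Subgroup.adModScalarRep H g m - m := fun i =>
    (cocycles₁_le_coboundaries₁_iff_forall (Rep.of (Subgroup.adModScalarRep H))).1 hH
      (fun g => P i (c' (ψ g))) (hc i)
  choose m hm using hm
  -- only finitely many coordinates occur in the values of `c'`
  haveI : Finite ↥(H.map (Matrix.GeneralLinearGroup.map (algebraMap k k'))) := Finite.of_equiv _ ψ.toEquiv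
  haveI : Fintype ↥(H.map (Matrix.GeneralLinearGroup.map (algebraMap k k'))) := Fintype.ofFinite _
  have hSg : ∀ g' : ↥(H.map (Matrix.GeneralLinearGroup.map (algebraMap k k'))),
      ∃ S : Finset (Module.Free.ChooseBasisIndex k k'), ∀ i ∉ S, P i (c' g') = 0 := fun g' =>
    exists_finset_coordQuot_eq_zero b hP (c' g')
  choose Sg hSg using hSg
  set S := Finset.univ.biUnion Sg with hSdef
  have hS : ∀ g' i, i ∉ S → P i (c' g') = 0 := fun g' i hi =>
    hSg g' i fun h => hi (Finset.mem_biUnion.2 ⟨g', Finset.mem_univ _, h⟩)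
  -- the primitive
  refine ⟨∑ i ∈ S, b i • J (m i), fun g' => ?_⟩
  obtain ⟨g, rfl⟩ := ψ.surjective g'
  change c' (ψ g) = adModScalar (Fin n) k'
      ((ψ g : ↥(H.map (Matrix.GeneralLinearGroup.map (algebraMap k k')))) : GL (Fin n) k')
      (∑ i ∈ S, b i • J (m i)) - ∑ i ∈ S, b i • J (m i)
  rw [hψ]
  rw [map_sum (adModScalar (Fin n) k' (Matrix.GeneralLinearGroup.map (algebraMap k k') (g : GL (Fin n) k)))]
  rw [← Finset.sum_sub_distrib]
  rw [eq_sum_smul_of_forall_coordQuot_eq_zero b hP hJ (c' (ψ g)) S (hS _)]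
  refine Finset.sum_congr rfl fun i _ => ?_
  rw [map_smul, ← smul_sub, hm i g, map_sub, ← inclQuot_adModScalar hJ]
  rfl

end Algebra

/-! ## 5. The packaged statements -/

/-- **Extended adequacy is stable under extension of the coefficient field** (any universes): for a
homomorphism of fields `φ : k → k'` and a finite `H ≤ GL_n(k)` adequate in the extended sense of
Guralnick–Herzig–Tiep §1 = Thorne 2017 Def. 2.20, the subgroup `GL_n(φ) H ≤ GL_n(k')` is adequate. -/
theorem isExtendedAdequate_map_ringHom {k : Type u} {k' : Type v} [Field k] [Field k'] {n : ℕ} (φ : k →+* k')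
    {H : Subgroup (GL (Fin n) k)} [Finite H] (hH : Subgroup.IsExtendedAdequate H) :
    Subgroup.IsExtendedAdequate (H.map (Matrix.GeneralLinearGroup.map φ)) := by
  letI : Algebra k k' := φ.toAlgebra
  exact ⟨addMonoidHom_eq_zero_baseChange φ hH.addMonoidHom_eq_zero,
    cocycles₁_le_coboundaries₁_baseChange (k := k) (k' := k') hH.cocycles₁_le_coboundaries₁,
    semisimpleSpan_eq_top_baseChange φ hH.semisimpleSpan_eq_top⟩

/-- **`isExtendedAdequate_baseChange` (registered helper of P2).**  For fields `k, k'` (level `0`: the case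
`𝔽₃ → ℤ̄₃/𝔪` of the line), a homomorphism `φ : k → k'` and a FINITE subgroup `H ≤ GL_n(k)` which is adequate in
the extended sense (GHT 2017 §1 = Thorne, Math. Z. 285 (2017) Def. 2.20: `Hom(H,k) = 0`, `H¹(H, ad/Z) = 0`,
`M_n(k)` spanned by the semisimple elements of `H`), the image `GL_n(φ) H ≤ GL_n(k')` is adequate in the same
sense: clauses (i), (iii) by `addMonoidHom_eq_zero_baseChange`, `semisimpleSpan_eq_top_baseChange` (no finiteness
needed), clause (ii) by `cocycles₁_le_coboundaries₁_baseChange` (coordinates of a cocycle along a `k`-basis of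
`k'`; finiteness of `H` bounds the coordinates that occur). -/
theorem isExtendedAdequate_baseChange : ∀ {k k' : Type} [Field k] [Field k'] {n : ℕ} (φ : k →+* k') (H : Subgroup (GL (Fin n) k)) [Finite H], Subgroup.IsExtendedAdequate H → Subgroup.IsExtendedAdequate (H.map (Matrix.GeneralLinearGroup.map φ)) :=
  fun φ _ _ hH => isExtendedAdequate_map_ringHom φ hH

end

end Summit.Langlands.Langlands.Cruxes.MuOrdinaryFamilyRT.ThorneMinimalLift
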